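import Literature.Analysis.FluidPDE.HardSphereCollisionRecord
import Literature.Analysis.FluidPDE.HardSphereFreeStretch
import Literature.Analysis.FluidPDE.HardSphereDynamicsProofs
import Literature.MathematicalPhysics.KineticTheory.HardSphereEuler
import HarnessLib

/-!
# Would-be pairs are realised unless pre-empted
# (`stub_wouldBeRealised`, registered stub S2 of the line `Sketch` of the crux
# `JParityClosure.RateFloor`, stmt-AtomisticToContinuum-13080)

The second registered stub of the lead's skeleton of the line `Sketch` for the crux `RateFloor`
(lower bound on the collision counts of the deterministic hard-sphere flow on `𝕋³`, reduced by the
line to static would-be-pair counts via "a would-be pair is realised unless pre-empted").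

**Statement (S2, given S1).**  Assume the per-particle free-stretch property S1 (a particle `k` of
a hard-sphere trajectory `γ` with no collision in `(s, t]` sits at time `t` on its free flight issued
from `γ s`).  Then on a hard-sphere trajectory `γ` on `𝕋³`: if `s < t`, `i ≠ j`, neither `i` nor `j`
takes part in a collision during the OPEN interval `(s, t)`, and the free flights of `i` and `j`
issued from `γ s` are at minimal-image distance exactly `ε` at time `t`, then `i` and `j` collide at
time `t` (`Collide` = the ordered pair `(i, j)` or `(j, i)` is a contact pair of `γ t`).

**Proof.**  For `u ∈ [s, t)` the interval `(s, u]` lies inside `(s, t)`, so S1 puts `γ u i` (and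
`γ u j`) on the free flight: the position curves `u ↦ (γ u i).1` and
`u ↦ (freeFlight G (u - s) (γ s) i).1 = xᵢ(s) + proj ((u - s) • vᵢ(s))` agree on `[s, t)`.  Both are
continuous (`IsHardSphereTrajectory.pos_continuous`, `Torus.continuous_geometry_translate`) with
values in the Hausdorff space `𝕋³`, hence they agree on the closure `[s, t]` (`Set.EqOn.closure`,
`closure_Ico`), in particular at `t`.  So `‖sepVec xᵢ(t) xⱼ(t)‖ = ε`, and since `γ t` lies in the
hard-sphere domain (`IsHardSphereTrajectory.mem`), `(i, j)` is an ordered contact pair of `γ t`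
(`mem_contactPairs_iff_of_mem`).  No positivity of `ε` and no regularity of the geometry is used.

References: Gallagher–Saint-Raymond–Texier 2013 §4.1 (hard-sphere trajectories); elementary.
-/

noncomputable section

namespace Summit.AtomisticToContinuum.HydrodynamicLimit.Theorems

open MeasureTheory Set Filter Topology
open Literature.Analysis.FluidPDE Literature.MathematicalPhysics.KineticTheory

namespace RateFloorWouldBeRealised

/-- The free-flight POSITION of particle `k` issued from the configuration `z` at time `s`, as a
function of the running time `u` (flight duration `u - s`), is continuous on the flat torus `𝕋³`
(it is `u ↦ x_k + proj ((u - s) • v_k)`). [folklore] -/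
theorem continuous_freeFlight_apply_fst {N : ℕ} (s : ℝ) (z : Config N (Fin 3) T3) (k : Fin N) :
    Continuous fun u : ℝ => (freeFlight (Torus.geometry (Fin 3)) (u - s) z k).1 := by
  simp only [freeFlight_apply]
  exact (Torus.continuous_geometry_translate (z k).1).comp
    ((continuous_sub_right s).smul continuous_const)

/-- **Positions do not jump (per particle).**  If the position of particle `k` is continuous in
time and `γ u k` is the free flight issued from `γ s` for every `u ∈ [s, t)` (`s < t`), then the
POSITION of `k` at time `t` is the free-flight position after time `t - s` (two continuous curves in
the Hausdorff space `𝕋³` agreeing on `[s, t)` agree on its closure `[s, t]`). [folklore] -/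
theorem apply_fst_eq_freeFlight_of_forall_Ico {N : ℕ} {γ : ℝ → Config N (Fin 3) T3} {k : Fin N}
    (hcont : Continuous fun u => (γ u k).1) {s t : ℝ} (hst : s < t)
    (heq : ∀ u ∈ Ico s t, γ u k = freeFlight (Torus.geometry (Fin 3)) (u - s) (γ s) k) :
    (γ t k).1 = (freeFlight (Torus.geometry (Fin 3)) (t - s) (γ s) k).1 := by
  have hEq : EqOn (fun u => (γ u k).1)
      (fun u => (freeFlight (Torus.geometry (Fin 3)) (u - s) (γ s) k).1) (Ico s t) :=
    fun u hu => congrArg Prod.fst (heq u hu)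
  have hcl := hEq.closure hcont (continuous_freeFlight_apply_fst s (γ s) k)
  rw [closure_Ico hst.ne] at hcl
  exact hcl (right_mem_Icc.2 hst.le)

/-- **S2 · would-be pairs are realised unless pre-empted** (registered stub `stub_wouldBeRealised`
of the line `Sketch`, crux `JParityClosure.RateFloor`, stmt-AtomisticToContinuum-13080), stated
GIVEN the per-particle free-stretch property S1 (its antecedent).  On a hard-sphere trajectory on
`𝕋³`: if the free flights of `i ≠ j` issued from `γ s` are at minimal-image distance exactly `ε` at
time `t > s` and neither `i` nor `j` takes part in a collision during `(s, t)`, then `i` and `j`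
collide at time `t`.  Proof: by S1 both particles are on their free flights on `[s, t)`; positions
are continuous, so at time `t` they are the free-flight positions
(`apply_fst_eq_freeFlight_of_forall_Ico`), which are in contact; `γ t` lies in the hard-sphere
domain, so `(i, j)` is an ordered contact pair (`mem_contactPairs_iff_of_mem`). [folklore] -/
theorem stub_wouldBeRealised :
    (∀ (N : ℕ) (ε : ℝ) (γ : ℝ → Config N (Fin 3) T3),
      IsHardSphereTrajectory (Torus.geometry (Fin 3)) ε N γ →
      ∀ (s t : ℝ) (k : Fin N), s ≤ t →
        (∀ u ∈ Set.Ioc s t, u ∉ collisionTimesOf (Torus.geometry (Fin 3)) ε γ k) →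
        γ t k = freeFlight (Torus.geometry (Fin 3)) (t - s) (γ s) k) →
    ∀ (N : ℕ) (ε : ℝ) (γ : ℝ → Config N (Fin 3) T3),
    IsHardSphereTrajectory (Torus.geometry (Fin 3)) ε N γ →
    ∀ (s t : ℝ) (i j : Fin N), s < t → i ≠ j →
      (∀ u ∈ Set.Ioo s t, u ∉ collisionTimesOf (Torus.geometry (Fin 3)) ε γ i) →
      (∀ u ∈ Set.Ioo s t, u ∉ collisionTimesOf (Torus.geometry (Fin 3)) ε γ j) →
      ‖(Torus.geometry (Fin 3)).sepVec (freeFlight (Torus.geometry (Fin 3)) (t - s) (γ s) i).1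
          (freeFlight (Torus.geometry (Fin 3)) (t - s) (γ s) j).1‖ = ε →
      Collide (Torus.geometry (Fin 3)) ε (γ t) i j := by
  intro hS1 N ε γ h s t i j hst hij hi hj hnorm
  -- S1 on the sub-windows `(s, u] ⊆ (s, t)`, `u ∈ [s, t)`: `i` and `j` are on their free flights
  have hfree : ∀ k : Fin N,
      (∀ u ∈ Set.Ioo s t, u ∉ collisionTimesOf (Torus.geometry (Fin 3)) ε γ k) →
      ∀ u ∈ Ico s t, γ u k = freeFlight (Torus.geometry (Fin 3)) (u - s) (γ s) k :=
    fun k hk u hu => hS1 N ε γ h s u k hu.1 fun w hw => hk w ⟨hw.1, hw.2.trans_lt hu.2⟩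
  -- continuity of positions: at time `t` the positions are the free-flight positions
  have hi' := apply_fst_eq_freeFlight_of_forall_Ico (h.pos_continuous i) hst (hfree i hi)
  have hj' := apply_fst_eq_freeFlight_of_forall_Ico (h.pos_continuous j) hst (hfree j hj)
  -- contact inside the hard-sphere domain is membership in the ordered contact pairs
  refine Or.inl ((mem_contactPairs_iff_of_mem (h.mem t)).2 ⟨hij, ?_⟩)
  show ‖(Torus.geometry (Fin 3)).sepVec (γ t i).1 (γ t j).1‖ = ε
  rw [hi', hj']
  exact hnorm

end RateFloorWouldBeRealised

end Summit.AtomisticToContinuum.HydrodynamicLimit.Theorems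

end
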